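import Summits.QuantumFields.BalabanUV.T4Continuum.Support.VariationalVectorEndOfLeaves
import Summits.QuantumFields.BalabanUV.T4Continuum.Support.VariationalEffectiveHilbertVector

/-!
# T⁴ programme, spine node NE2 (U1a), lane P2 — THE VECTOR END MODULO THE LEAVES AT GENERAL `E` (finite-dimensional Hilbert values — the colour
# sector at model level): `towerLimitRate_effV_of_pairs` ∕ `…_of_leaves` re-instantiated on leaf-02-g4's `towerLimitRate_effVE`
# (`t4/skeletons/NE2-t4-ne2-p2.md` v0.15 §2.E «⟹ V-END»; model level; cell `pub-balaban`)

NE2 formalisation swarm `b2b-balaban-t4-ne2-formalise-*`, leaf prover 10 GEN 3 (`prover-b2b-balaban-t4-ne2-formalise-leaf-10-g3-0`, lineage V-COMP TOWER ∕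
V-END); journal INTENT CLAIMS.log 2026-08-20 14:43Z (leaf-02-g4's hand-over «the general-`E` twin is a re-instantiation — yours or mine», its seat closed).
On top of `VariationalVectorTower` (p218948: `vector_bracket_transport`, `Gtr`, `QvL_surjective_of_ub` — all stated for any normed `E`),
`VariationalVectorEndOfLeaves` (p220074: `eV`∕`ePV` and their rate lemmas, `nonneg_of_Gtr`∕`continuous_of_Gtr`, `continuous_qform`,
`vector_pair_brackets_of_leaves` — general `E`) and leaf-02-g4's D-E `VariationalEffectiveHilbertVector` (p220575: `uncV`, `effVE`, `towerLimitRate_effVE`;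
`VariationalEffectiveHilbert.flatE`) — BY NAME; nothing defined.

THE POINT.  Every vector leaf in the tree — V-UB-L (p218278 ∕ p220640), V-FED (p217269), V-ONE-1F (p219670 ff.), (Går) (p219068), the gauge-slice bracket
(p220652) — is stated for `E`-VALUED 1-forms with OPERATOR transports (the colour sector at model level), while the END of p218948 ∕ p220074 was typed at
`E = ℂ`.  With leaf-02-g4's effective operator `effVE` on `(Tor M × Fin d) × κ` (`κ` an orthonormal basis index of `E`):
 * §1 the (GF0) ∕ continuity binders from the flattened matrix form `G = qform Gm ∘ flatE b ∘ uncV` (`continuous_uncV`, `continuous_flatE`,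
   `nonneg_of_qformE`, `continuous_of_qformE`);
 * §2 **`towerLimitRate_effVE_of_pairs`** — p218948 §4 at general `E`: per-level PAIR-shaped brackets + the COMP DATA identities `hTcomp`∕`hRtr`∕`hGtr` ⟹
   `towerLimitRate_effVE`'s consecutive-level brackets (`vector_bracket_transport` + `rfl`);
 * §3 **`towerLimitRate_effVE_of_leaves`** — p220074's END at general `E`: binders = an orthonormal basis `b`, `Gm k` PSD with
   `G k W = qform (Gm k) (flatE b (uncV W))`, the COMP identities, one-step `QvL (T′ k)` onto, `0 < a`, the five leaf families of `vector_pair_bracket_sqrt`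
   VERBATIM, uniform level constants and geometric decay of `δ`∕`ε₁`∕`δ′` ⟹
   `TowerLimitRate (fun _ ↦ 1) 1 (k ↦ effVE (L^k) M (R k) (Gm k) (T k) b a) (eV Λ⋆ C_P⋆ c_δ + ePV Λ⋆ C_P⋆ C_R⋆ c_ε c_δ′) θ`.
(GF0), continuity and `Qk`-surjectivity DERIVED as in p220074.  The slice and class variants (`…EndOfLeavesSlice`, `…EndClass`) transfer verbatim (not repeated).

HONEST FRAMING (T4-DAG p. 1).  Model level; transports ∕ frames ∕ functionals DATA (no identification with Bałaban's `U(Γ)`, minimisers — c5); [folklore] plumbing;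
nothing printed is a hypothesis; no `def`, no `def … : Prop`, no `sorry`; axioms standard.  Every leaf DISPLAYED; V-GF ∕ V-REG OPEN; V-END NOT proved; NE2 NOT
proved; spine PROVED 0∕9 unchanged; rung (B)+1 finite T⁴ — NOT infinite volume, NOT mass gap, NOT Clay.  HONEST DEPENDENCY (cell, verbatim): continuum YM on T⁴
⇐ BetaPertH ∧ nine spine estimates (0/9 proved); BetaPertH ⇐ (D1) ∧ (D4) ∧ CAP+tail; G-an2-4 gates asym, D1 and NE2/3/4.
-/

noncomputable section

namespace Summit.QuantumFields.BalabanUV.T4Continuum.VariationalVectorEndOfLeaves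

open Finset
open scoped Matrix ComplexConjugate ComplexOrder Matrix.Norms.L2Operator BigOperators InnerProductSpace
open Literature.MathematicalPhysics.QuantumFieldTheory.Balaban1983to89.B5Prop11Plancherel (Tor fine unitVec)
open Literature.Analysis.Complex (qform qform_nonneg_of_posSemidef)
open Summit.QuantumFields.BalabanUV.T4Continuum.VariationalTransfer (blockSpin)
open Summit.QuantumFields.BalabanUV.T4Continuum.VariationalColourTower (Rtrv)
open Summit.QuantumFields.BalabanUV.T4Continuum.CovariantAveragingTower (TowerLimitRate)
open Summit.QuantumFields.BalabanUV.T4Continuum.VectorBlockTrialForm (nsqV nsqV_nonneg QvL compL)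
open Summit.QuantumFields.BalabanUV.T4Continuum.VariationalVectorForm
open Summit.QuantumFields.BalabanUV.T4Continuum.VariationalVectorAverage (continuous_QvL)
open Summit.QuantumFields.BalabanUV.T4Continuum.VariationalVectorTower (Gtr QvL_surjective_of_ub vector_bracket_transport)
open Summit.QuantumFields.BalabanUV.T4Continuum.VariationalEffectiveHilbert (flatE)
open Summit.QuantumFields.BalabanUV.T4Continuum.VariationalEffectiveHilbertVector (uncV effVE towerLimitRate_effVE)

variable {d : ℕ} {E : Type*} [NormedAddCommGroup E] [InnerProductSpace ℂ E]
variable {κ : Type*} [Fintype κ] [DecidableEq κ]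

/-! ## §1 (GF0) and continuity from the flattened matrix form -/

section Functional

omit [InnerProductSpace ℂ E] in
/-- uncurrying a 1-form onto the product index is continuous. [folklore] -/
theorem continuous_uncV {α : Type*} : Continuous (fun W : α → Fin d → E => uncV W) :=
  continuous_pi fun p => (continuous_apply p.2).comp (continuous_apply p.1)

omit [DecidableEq κ] in
/-- flattening in an orthonormal basis is continuous. [folklore] -/
theorem continuous_flatE {ι : Type*} (b : OrthonormalBasis κ ℂ E) : Continuous (fun φ : ι → E => flatE b φ) :=
  continuous_pi fun p => continuous_const.inner (continuous_apply p.1)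

variable (n : ℕ) [NeZero n] (M : Fin d → ℕ) [hM : ∀ μ, NeZero (M μ)]

omit [DecidableEq κ] in
/-- (GF0) from the flattened matrix form: `G = qform Gm ∘ flatE b ∘ uncV`, `Gm` PSD ⟹ `0 ≤ G`. [folklore] -/
theorem nonneg_of_qformE (b : OrthonormalBasis κ ℂ E) {Gm : Matrix ((Tor (fine n M) × Fin d) × κ) ((Tor (fine n M) × Fin d) × κ) ℂ}
    (hGm : Gm.PosSemidef) {G : (Tor (fine n M) → Fin d → E) → ℝ} (hG : ∀ W, G W = qform Gm (flatE b (uncV W)))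
    (W : Tor (fine n M) → Fin d → E) : 0 ≤ G W := by
  rw [hG]; exact qform_nonneg_of_posSemidef hGm _

omit [DecidableEq κ] in
/-- continuity from the flattened matrix form. [folklore] -/
theorem continuous_of_qformE (b : OrthonormalBasis κ ℂ E) {Gm : Matrix ((Tor (fine n M) × Fin d) × κ) ((Tor (fine n M) × Fin d) × κ) ℂ}
    {G : (Tor (fine n M) → Fin d → E) → ℝ} (hG : ∀ W, G W = qform Gm (flatE b (uncV W))) : Continuous G := by
  have h : G = fun W => qform Gm (flatE b (uncV W)) := funext hG
  rw [h]
  exact (continuous_qform Gm).comp ((continuous_flatE b).comp continuous_uncV)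

end Functional

/-! ## §2 The pair-shaped brackets + the COMP identities feed `towerLimitRate_effVE` -/

section Tower

variable (L : ℕ) [NeZero L] (M : Fin d → ℕ) [hM : ∀ μ, NeZero (M μ)]
variable (R : (k : ℕ) → Tor (fine (L ^ k) M) → Fin d → (E →L[ℂ] E))
variable (R' : (k : ℕ) → Tor (fine L (fine (L ^ k) M)) → Fin d → (E →L[ℂ] E))
variable (Gm : (k : ℕ) → Matrix ((Tor (fine (L ^ k) M) × Fin d) × κ) ((Tor (fine (L ^ k) M) × Fin d) × κ) ℂ)
variable (G : (k : ℕ) → (Tor (fine (L ^ k) M) → Fin d → E) → ℝ)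
variable (G' : (k : ℕ) → (Tor (fine L (fine (L ^ k) M)) → Fin d → E) → ℝ)
variable (T : (k : ℕ) → Tor M → (Fin d → Fin (L ^ k)) → Fin (L ^ k) → Fin d → (E →L[ℂ] E))
variable (T' : (k : ℕ) → Tor (fine (L ^ k) M) → (Fin d → Fin L) → Fin L → Fin d → (E →L[ℂ] E))

/-- **THE η-RATE CURRENCY FOR THE E-VALUED VECTOR SPECIES ON THE `QvL` CARRIERS, FROM THE CANONICAL-PAIR BRACKETS** (p218948 §4 at general `E`):
along `n_k = L^k`, PSD `Gm k` with `G k = qform (Gm k) ∘ flatE b ∘ uncV`, `QvL (T k)` onto, V-P-shaped coercivity per level, the COMP DATA identities and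
GEOMETRIC pair-shaped brackets (between `blockSpin (Q_{T_k}) (ScV_k)` and the fine member `blockSpin (Q_{T_k} ∘ Q_{T′_k}) (SfV_k)`) ⟹
`TowerLimitRate (fun _ ↦ 1) 1 (k ↦ effVE (L^k) M (R k) (Gm k) (T k) b a) C ρ`. [folklore] -/
theorem towerLimitRate_effVE_of_pairs (b : OrthonormalBasis κ ℂ E) (hGm : ∀ k, (Gm k).PosSemidef)
    (hG : ∀ k W, G k W = qform (Gm k) (flatE b (uncV W)))
    (hsurj : ∀ k, Function.Surjective (QvL (L ^ k) M (T k))) {CP : ℕ → ℝ}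
    (hP : ∀ k W, qWV (L ^ k) M W ≤ CP k * (ScV (L ^ k) M (R k) (G k) W + nsqV M (QvL (L ^ k) M (T k) W)))
    (hTcomp : ∀ k, T (k + 1) = compL (L ^ k) L M (T k) (T' k)) (hRtr : ∀ k, R (k + 1) = Rtrv (L ^ k) L M (R' k))
    (hGtr : ∀ k, G (k + 1) = Gtr (L ^ k) L M (G' k))
    {a : ℝ} (ha : 0 < a) {C ρ : ℝ} (hC : 0 ≤ C) (hρ : 0 ≤ ρ) (hρ1 : ρ < 1) (e e' : ℕ → ℝ) (he : ∀ k, e k ≤ C * ρ ^ k)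
    (he' : ∀ k, e' k ≤ C * ρ ^ k)
    (hbr : ∀ k (φ : Tor M → Fin d → E), blockSpin (QvL (L ^ k) M (T k)) (ScV (L ^ k) M (R k) (G k)) φ
        ≤ blockSpin (QvL (L ^ k) M (T k) ∘ QvL L (fine (L ^ k) M) (T' k)) (SfV (L ^ k) L M (R' k) (G' k)) φ + e k * nsqV M φ ∧
      blockSpin (QvL (L ^ k) M (T k) ∘ QvL L (fine (L ^ k) M) (T' k)) (SfV (L ^ k) L M (R' k) (G' k)) φ
        ≤ blockSpin (QvL (L ^ k) M (T k)) (ScV (L ^ k) M (R k) (G k)) φ + e' k * nsqV M φ) :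
    TowerLimitRate (ι := fun _ => (Tor M × Fin d) × κ) (fun _ => (1 : Matrix ((Tor M × Fin d) × κ) ((Tor M × Fin d) × κ) ℂ)) 1
      (fun k => effVE (L ^ k) M (R k) (Gm k) (T k) b a) C ρ := by
  refine towerLimitRate_effVE L M R Gm G T b hGm hG hsurj hP ha hC hρ hρ1 e e' he he' fun k φ => ?_
  have hlev : blockSpin (QvL (L ^ (k + 1)) M (T (k + 1))) (ScV (L ^ (k + 1)) M (R (k + 1)) (G (k + 1))) φ
      = blockSpin (QvL (L ^ k * L) M (compL (L ^ k) L M (T k) (T' k)))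
          (ScV (L ^ k * L) M (Rtrv (L ^ k) L M (R' k)) (Gtr (L ^ k) L M (G' k))) φ := by
    rw [hTcomp k, hRtr k, hGtr k]; rfl
  rw [hlev]
  exact vector_bracket_transport (L ^ k) L M (hbr k φ)

/-! ## §3 THE VECTOR END MODULO THE LEAVES AT GENERAL `E` -/

/-- **THE VECTOR END OF ROAD P2 MODULO THE LEAVES, E-VALUED 1-FORMS** (p220074's `towerLimitRate_effV_of_leaves` at general finite-dimensional Hilbert `E`):
tower data `R k`, `R′ k`, PSD `Gm k` on `(Tor (fine (L^k) M) × Fin d) × κ` with `G k W = qform (Gm k) (flatE b (uncV W))` (`b` an orthonormal basis of `E`),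
one-step functionals `G′ k`, line transports `T k`, `T′ k`, the COMP DATA identities, `QvL (T′ k)` onto, the five vector leaves DISPLAYED per level in
`vector_pair_bracket_sqrt`'s letters with level constants `≤` starred constants and the three small parameters decaying geometrically (`0 ≤ θ < 1`), `0 < a`
⟹ `TowerLimitRate (fun _ ↦ 1) 1 (k ↦ effVE (L^k) M (R k) (Gm k) (T k) b a) (eV Λ⋆ C_P⋆ c_δ + ePV Λ⋆ C_P⋆ C_R⋆ c_ε c_δ′) θ` on `(Tor M × Fin d) × κ`.
Every leaf DISPLAYED; (GF0), continuity, `Qk`-surjectivity DERIVED; nothing of NE3. [folklore] -/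
theorem towerLimitRate_effVE_of_leaves [FiniteDimensional ℂ E] (b : OrthonormalBasis κ ℂ E) (hGm : ∀ k, (Gm k).PosSemidef)
    (hG : ∀ k W, G k W = qform (Gm k) (flatE b (uncV W)))
    (hTcomp : ∀ k, T (k + 1) = compL (L ^ k) L M (T k) (T' k)) (hRtr : ∀ k, R (k + 1) = Rtrv (L ^ k) L M (R' k))
    (hGtr : ∀ k, G (k + 1) = Gtr (L ^ k) L M (G' k))
    (hsurj₁ : ∀ k, Function.Surjective (QvL L (fine (L ^ k) M) (T' k)))
    {a : ℝ} (ha : 0 < a)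
    (Λ CP CR δ ε₁ δ' : ℕ → ℝ) {Λs CPs CRs cδ cε cδ' θ : ℝ}
    (hΛ : ∀ k, 0 ≤ Λ k) (hΛs : ∀ k, Λ k ≤ Λs) (hCP : ∀ k, 0 ≤ CP k) (hCPs : ∀ k, CP k ≤ CPs) (hCR : ∀ k, 0 ≤ CR k) (hCRs : ∀ k, CR k ≤ CRs)
    (hδ : ∀ k, 0 ≤ δ k) (hε₁ : ∀ k, 0 ≤ ε₁ k) (hδ' : ∀ k, 0 ≤ δ' k) (hθ : 0 ≤ θ) (hθ1 : θ < 1)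
    (hδθ : ∀ k, δ k ≤ cδ * θ ^ k) (hεθ : ∀ k, ε₁ k ≤ cε * θ ^ k) (hδ'θ : ∀ k, δ' k ≤ cδ' * θ ^ k)
    {ρV : (k : ℕ) → (Tor (fine (L ^ k) M) → Fin d → E) → ℝ} (hρ0 : ∀ k W, 0 ≤ ρV k W)
    -- leaf V-UB at both levels
    (hUBc : ∀ k (φ : Tor M → Fin d → E), ∃ W, QvL (L ^ k) M (T k) W = φ ∧ ScV (L ^ k) M (R k) (G k) W ≤ Λ k * nsqV M φ)
    (hUBf : ∀ k (φ : Tor M → Fin d → E), ∃ W', QvL (L ^ k) M (T k) (QvL L (fine (L ^ k) M) (T' k) W') = φ ∧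
      SfV (L ^ k) L M (R' k) (G' k) W' ≤ Λ k * nsqV M φ)
    -- leaf V-P at both levels
    (hPc : ∀ k W, qWV (L ^ k) M W ≤ CP k * (ScV (L ^ k) M (R k) (G k) W + nsqV M (QvL (L ^ k) M (T k) W)))
    (hPf : ∀ k W', qVV (L ^ k) L M W' ≤ CP k * (SfV (L ^ k) L M (R' k) (G' k) W' + nsqV M (QvL (L ^ k) M (T k) (QvL L (fine (L ^ k) M) (T' k) W'))))
    -- leaf V-FED
    (hFED : ∀ k W', ScV (L ^ k) M (R k) (G k) (QvL L (fine (L ^ k) M) (T' k) W')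
      ≤ (Real.sqrt (SfV (L ^ k) L M (R' k) (G' k) W') + δ k * Real.sqrt (qVV (L ^ k) L M W')) ^ 2)
    -- leaf V-ONE (square-root shape) and leaf V-REG
    (hONE : ∀ k W, blockSpin (QvL L (fine (L ^ k) M) (T' k)) (SfV (L ^ k) L M (R' k) (G' k)) W
      ≤ (Real.sqrt (ScV (L ^ k) M (R k) (G k) W + ε₁ k * ρV k W) + δ' k * Real.sqrt (qWV (L ^ k) M W)) ^ 2)
    (hREG : ∀ k (φ : Tor M → Fin d → E) W, QvL (L ^ k) M (T k) W = φ →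
      (∀ W₂, QvL (L ^ k) M (T k) W₂ = φ → ScV (L ^ k) M (R k) (G k) W ≤ ScV (L ^ k) M (R k) (G k) W₂) →
      ρV k W ≤ CR k * (ScV (L ^ k) M (R k) (G k) W + nsqV M φ)) :
    TowerLimitRate (ι := fun _ => (Tor M × Fin d) × κ) (fun _ => (1 : Matrix ((Tor M × Fin d) × κ) ((Tor M × Fin d) × κ) ℂ)) 1
      (fun k => effVE (L ^ k) M (R k) (Gm k) (T k) b a) (eV Λs CPs cδ + ePV Λs CPs CRs cε cδ') θ := by
  -- (GF0) and continuity at every level, from the flattened matrix form and one step up through `Gtr`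
  have hG0 : ∀ k W, 0 ≤ G k W := fun k => nonneg_of_qformE (L ^ k) M b (hGm k) (hG k)
  have hGc : ∀ k, Continuous (G k) := fun k => continuous_of_qformE (L ^ k) M b (hG k)
  have hG0' : ∀ k W', 0 ≤ G' k W' := fun k => nonneg_of_Gtr (L ^ k) L M (hGtr k) (hG0 (k + 1))
  have hGc' : ∀ k, Continuous (G' k) := fun k => continuous_of_Gtr (L ^ k) L M (hGtr k) (hGc (k + 1))
  -- the starred constants are nonnegative (level 0)
  have hθ1' : θ ≤ 1 := hθ1.le
  have hΛs0 : 0 ≤ Λs := (hΛ 0).trans (hΛs 0)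
  have hCPs0 : 0 ≤ CPs := (hCP 0).trans (hCPs 0)
  have hCRs0 : 0 ≤ CRs := (hCR 0).trans (hCRs 0)
  have hcδ : 0 ≤ cδ := by have := (hδ 0).trans (hδθ 0); simpa using this
  have hcε : 0 ≤ cε := by have := (hε₁ 0).trans (hεθ 0); simpa using this
  have hcδ' : 0 ≤ cδ' := by have := (hδ' 0).trans (hδ'θ 0); simpa using this
  have hC : 0 ≤ eV Λs CPs cδ + ePV Λs CPs CRs cε cδ' := add_nonneg (eV_nonneg hΛs0 hCPs0 hcδ) (ePV_nonneg hΛs0 hCPs0 hCRs0 hcε hcδ')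
  -- per-level rates of the two defects
  have he : ∀ k, eV (Λ k) (CP k) (δ k) ≤ (eV Λs CPs cδ + ePV Λs CPs CRs cε cδ') * θ ^ k := fun k => by
    have h1 := eV_level_le k (hΛ k) (hΛs k) (hCP k) (hCPs k) (hδ k) hθ hθ1' (hδθ k)
    have h2 : 0 ≤ ePV Λs CPs CRs cε cδ' * θ ^ k := mul_nonneg (ePV_nonneg hΛs0 hCPs0 hCRs0 hcε hcδ') (pow_nonneg hθ k)
    linarith [add_mul (eV Λs CPs cδ) (ePV Λs CPs CRs cε cδ') (θ ^ k)]
  have he' : ∀ k, ePV (Λ k) (CP k) (CR k) (ε₁ k) (δ' k) ≤ (eV Λs CPs cδ + ePV Λs CPs CRs cε cδ') * θ ^ k := fun k => by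
    have h1 := ePV_level_le k (hΛ k) (hΛs k) (hCP k) (hCPs k) (hCR k) (hCRs k) (hε₁ k) hcε (hδ' k) hcδ' hθ hθ1' (hεθ k) (hδ'θ k)
    have h2 : 0 ≤ eV Λs CPs cδ * θ ^ k := mul_nonneg (eV_nonneg hΛs0 hCPs0 hcδ) (pow_nonneg hθ k)
    linarith [add_mul (eV Λs CPs cδ) (ePV Λs CPs CRs cε cδ') (θ ^ k)]
  -- the brackets from the leaves, level by level, fed to the pair-to-rate currency at general `E`
  exact towerLimitRate_effVE_of_pairs L M R R' Gm G G' T T' b hGm hG (fun k => QvL_surjective_of_ub (L ^ k) M (hUBc k)) hPc hTcomp hRtr hGtr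
    ha hC hθ hθ1 (fun k => eV (Λ k) (CP k) (δ k)) (fun k => ePV (Λ k) (CP k) (CR k) (ε₁ k) (δ' k)) he he'
    fun k φ => vector_pair_brackets_of_leaves (L ^ k) L M (hsurj₁ k) (hG0 k) (hGc k) (hG0' k) (hGc' k) (hΛ k) (hCP k) (hCR k) (hδ k) (hε₁ k)
      (hδ' k) (hρ0 k) (hUBc k) (hUBf k) (hPc k) (hPf k) (hFED k) (hONE k) (hREG k) φ

end Tower

end Summit.QuantumFields.BalabanUV.T4Continuum.VariationalVectorEndOfLeaves

end
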